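/-
Copyright (c) 2026. All rights reserved.
Released under Apache 2.0 license as described in the file LICENSE.
Authors: abc-iut cell, prover seat abc-iut-w5-d138 (wave 5, gen 4).
-/
import Literature.IUT.LogVolume.UnitLogIntoMaximalIdeal
import Literature.IUT.LogVolume.PadicSubfields
import HarnessLib

/-!
# Wild ramification at EVERY odd prime: `πᵖ = p` ⇒ the logarithm `log_p(1 + π)` is a UNIT

Proof-only companion (theorems, no definitions) of abc-iut-w5-d172's `UnitLogIntoMaximalIdeal.lean`
(`e(K/ℚ_p) ≤ p − 1 ⇒ log_p(𝒪_K^×) ⊆ 𝔪_K`: the logarithm of a unit is never a unit) and of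
`WildCubicUnitLogUnit.lean` (its sharpness at the single prime `p = 3`, `π³ = 3`).  THIS FILE proves the
sharpness at EVERY ODD PRIME `p` at once, by the direct term estimate and without coordinates: for any
complete ultrametric normed `ℚ_p`-algebra field `K` and any `π ∈ K` with `πᵖ = p` (so `‖π‖ = p^{−1/p}`,
`e(K/ℚ_p) ≥ p`; e.g. `K ⊇ ℚ_p(p^{1/p})`):

* in the logarithmic series `L(1 + π) = Σ_{k ≥ 1} (−1)^{k+1} πᵏ/k` the term of index `k = p` is
  `πᵖ/p = 1`, of norm `1` (`norm_logTerm_prime`), while EVERY other term has norm `≤ ‖π‖ < 1`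
  (`norm_logTerm_le_of_ne`: for `p ∤ k` it is `‖π‖ᵏ ≤ ‖π‖`; for `k = pm`, `m ≥ 2`, it is
  `p^{v_p(m) + 1 − m} ≤ p^{−1} = ‖π‖ᵖ ≤ ‖π‖` because `v_p(m) + 2 ≤ m` for `m ≥ 2`, `p ≥ 3` —
  `padicValNat_add_two_le`; this is exactly where `p ≠ 2` enters: at `p = 2` the terms `k = 2, 4` both have
  norm `1` and cancel modulo `𝔪`, cf. `UnitLogWildDyadic.lean`);
* hence **`‖log_p(1 + π)‖ = 1`** (`norm_unitLog_one_add_pi_eq_one`, ultrametric inequality with a unique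
  dominant term), `log_p(𝒪_K^×)` MEETS the unit sphere (`logUnits_inter_sphere_nonempty`,
  `not_logUnits_subset_ball`), and `¬ e(K/ℚ_p) ≤ p − 1` (`not_absRamificationIdx_le_sub_one`, from
  abc-iut-w5-d172's theorem BY NAME: such `K` are wildly ramified with `e ≥ p`);
* NON-VACUITY for every prime `p`: `ℚ_p(p^{1/p}) ⊆ ℚ̄_p` is a finite extension containing such a `π`
  (`exists_subfield_pow_prime_eq`, Mathlib's `PadicAlgCl p` + abc-iut-S1's `PadicSubfields` instances), so for
  every ODD `p` there is a finite `E ⊆ ℚ̄_p` with a unit whose logarithm is a unit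
  (`exists_subfield_norm_unitLog_eq_one`).

Classical local arithmetic (Neukirch, *Algebraic Number Theory*, Ch. II (5.5): `log` maps `U^{(n)}` onto
`𝔭ⁿ` only for `n > e/(p−1)`).  Consumer: the (Ind3) depth-`2` census of the honest log-link iterates
([IUTchIII] Rmk 1.1.1 (i)) — `Literature/IUT/LogThetaLattice/LogLinkIteratesWildPrime.lean`.  Nothing here is
disputed mathematics; no IUT statement is asserted; nothing bears on [IUTchIII] Cor. 3.12.
-/

noncomputable section

open Metric Set

namespace Literature.IUT.LogVolume

namespace WildPrime

variable {p : ℕ} [hp : Fact p.Prime]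
variable {K : Type*} [NontriviallyNormedField K] [instK : NormedAlgebra ℚ_[p] K] {π : K}

/-! ### Arithmetic of the exponents -/

/-- **`v_p(m) + 2 ≤ m`** for `m ≥ 2` and `p` an odd prime (`p ≥ 3`): `p^{v_p(m)} ∣ m` gives
`v_p(m) + 2 ≤ 3^{v_p(m)} ≤ p^{v_p(m)} ≤ m` when `v_p(m) ≥ 1`. (False at `p = 2`, `m ∈ {2, 4}`.)
[cite: NeukirchANT1999, Ch. II (5.5)] -/
theorem padicValNat_add_two_le (hp2 : p ≠ 2) {m : ℕ} (hm : 2 ≤ m) : padicValNat p m + 2 ≤ m := by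
  have hp3 : 3 ≤ p := by
    have := hp.out.two_le
    omega
  rcases Nat.eq_zero_or_pos (padicValNat p m) with h0 | hpos
  · rw [h0]; exact hm
  · have hdvd : p ^ padicValNat p m ∣ m := pow_padicValNat_dvd
    have hle : p ^ padicValNat p m ≤ m := Nat.le_of_dvd (by omega) hdvd
    have h3 : 3 ^ padicValNat p m ≤ p ^ padicValNat p m := Nat.pow_le_pow_left hp3 _
    -- `v + 2 ≤ 3 ^ v` for `v ≥ 1` (Bernoulli)
    have h2 : ∀ v : ℕ, 1 ≤ v → v + 2 ≤ 3 ^ v := by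
      intro v hv
      induction v with
      | zero => omega
      | succ n ih =>
        rcases Nat.eq_zero_or_pos n with rfl | hn
        · norm_num
        · have := ih hn
          rw [pow_succ]
          omega
    have h2' := h2 _ hpos
    omega

/-! ### `‖π‖` -/

/-- `‖π‖ᵖ = p⁻¹` (`‖πᵖ‖ = ‖p‖ = p⁻¹`). [cite: NeukirchANT1999, Ch. II (5.5)] -/
theorem norm_pi_pow (hπ : π ^ p = p) : ‖π‖ ^ p = (p : ℝ)⁻¹ := by
  rw [← norm_pow, hπ, norm_prime p K]

/-- `‖π‖ < 1`. [cite: NeukirchANT1999, Ch. II (5.5)] -/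
theorem norm_pi_lt_one (hπ : π ^ p = p) : ‖π‖ < 1 := by
  have hp1 : (1 : ℝ) < p := by exact_mod_cast hp.out.one_lt
  have hlt : ‖π‖ ^ p < 1 := by
    rw [norm_pi_pow hπ]
    exact inv_lt_one_of_one_lt₀ hp1
  exact lt_of_pow_lt_pow_left₀ p zero_le_one (by rwa [one_pow])

/-- `p⁻¹ ≤ ‖π‖` (`p⁻¹ = ‖π‖ᵖ ≤ ‖π‖` as `‖π‖ ≤ 1`, `p ≥ 1`). [cite: NeukirchANT1999, Ch. II (5.5)] -/
theorem inv_prime_le_norm_pi (hπ : π ^ p = p) : (p : ℝ)⁻¹ ≤ ‖π‖ := by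
  rw [← norm_pi_pow hπ]
  calc ‖π‖ ^ p ≤ ‖π‖ ^ 1 :=
        pow_le_pow_of_le_one (norm_nonneg _) (norm_pi_lt_one hπ).le hp.out.one_le
    _ = ‖π‖ := pow_one _

/-- `1 + π` is a principal unit: `‖1 − (1 + π)‖ = ‖π‖ < 1`. [cite: NeukirchANT1999, Ch. II (5.3)] -/
theorem isPrincipal_one_add_pi (hπ : π ^ p = p) : IsPrincipal (1 + π) := by
  show ‖1 - (1 + π)‖ < 1
  rw [show (1 : K) - (1 + π) = -π by ring, norm_neg]
  exact norm_pi_lt_one hπ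

/-- `‖1 + π‖ = 1`. [cite: NeukirchANT1999, Ch. II (5.3)] -/
theorem norm_one_add_pi [IsUltrametricDist K] (hπ : π ^ p = p) : ‖1 + π‖ = 1 :=
  (isPrincipal_one_add_pi hπ).norm_eq_one

/-! ### The terms of the logarithmic series at `y = 1 + π` -/

/-- The `n`-th term of `L(1 + π)` has norm `‖π‖^{n+1} · p^{v_p(n+1)}`.
[cite: NeukirchANT1999, Ch. II (5.5)] -/
theorem norm_logTerm_eq (p : ℕ) [Fact p.Prime] [NormedAlgebra ℚ_[p] K] (π : K) (n : ℕ) :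
    ‖-((1 - (1 + π)) ^ (n + 1)) / (n + 1 : K)‖ = ‖π‖ ^ (n + 1) * (p : ℝ) ^ padicValNat p (n + 1) := by
  rw [LogVolume.norm_logTerm_eq p K (1 + π) n, show (1 : K) - (1 + π) = -π by ring, norm_neg]

/-- **The dominant term**: the term of index `k = p` of `L(1 + π)` is `± πᵖ/p = ± 1`, of norm `1`.
[cite: NeukirchANT1999, Ch. II (5.5)] -/
theorem norm_logTerm_prime (hπ : π ^ p = p) :
    ‖-((1 - (1 + π)) ^ (p - 1 + 1)) / ((p - 1 : ℕ) + 1 : K)‖ = 1 := by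
  have hp0 : (p : ℝ) ≠ 0 := by exact_mod_cast hp.out.ne_zero
  rw [show ((p - 1 : ℕ) + 1 : K) = ((p - 1 : ℕ) : K) + 1 by norm_cast, norm_logTerm_eq p π (p - 1),
    Nat.sub_add_cancel hp.out.one_le, norm_pi_pow hπ, padicValNat_self, pow_one, inv_mul_cancel₀ hp0]

/-- **Every other term is small**: for `n + 1 ≠ p` the `n`-th term of `L(1 + π)` has norm `≤ ‖π‖`
(`p ∤ n+1`: `‖π‖^{n+1} ≤ ‖π‖`; `n + 1 = pm`, `m ≥ 2`: `p^{v_p(m)+1−m} ≤ p⁻¹ ≤ ‖π‖`, by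
`padicValNat_add_two_le` — here `p ≠ 2` is used). [cite: NeukirchANT1999, Ch. II (5.5)] -/
theorem norm_logTerm_le_of_ne (hp2 : p ≠ 2) (hπ : π ^ p = p) {n : ℕ} (hn : n + 1 ≠ p) :
    ‖-((1 - (1 + π)) ^ (n + 1)) / (n + 1 : K)‖ ≤ ‖π‖ := by
  rw [norm_logTerm_eq p π n]
  have hπ0 : 0 ≤ ‖π‖ := norm_nonneg π
  have hπ1 : ‖π‖ ≤ 1 := (norm_pi_lt_one hπ).le
  have hp1 : (1 : ℝ) ≤ p := by exact_mod_cast hp.out.one_le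
  have hp0 : (0 : ℝ) < p := by exact_mod_cast hp.out.pos
  by_cases hdvd : p ∣ n + 1
  · -- `n + 1 = p * m` with `m ≥ 2`
    obtain ⟨m, hm⟩ := hdvd
    have hm0 : m ≠ 0 := by rintro rfl; simp at hm
    have hm1 : m ≠ 1 := by rintro rfl; rw [mul_one] at hm; exact hn hm
    have hm2 : 2 ≤ m := by omega
    have hval : padicValNat p (n + 1) = padicValNat p m + 1 := by
      rw [hm, padicValNat.mul hp.out.ne_zero hm0, padicValNat_self, add_comm]
    have hkey := padicValNat_add_two_le hp2 hm2
    rw [hval, hm, pow_mul, norm_pi_pow hπ, inv_pow]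
    -- `p^{-m} · p^{v+1} ≤ p⁻¹ ≤ ‖π‖`
    calc ((p : ℝ) ^ m)⁻¹ * (p : ℝ) ^ (padicValNat p m + 1)
        ≤ ((p : ℝ) ^ m)⁻¹ * (p : ℝ) ^ (m - 1) :=
          mul_le_mul_of_nonneg_left (pow_le_pow_right₀ hp1 (by omega)) (by positivity)
      _ = (p : ℝ)⁻¹ := by
          have hpm : (p : ℝ) ^ m = (p : ℝ) ^ (m - 1) * p := by
            rw [← pow_succ, Nat.sub_add_cancel (by omega : 1 ≤ m)]
          rw [hpm, mul_inv, mul_assoc, mul_comm (p : ℝ)⁻¹, ← mul_assoc,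
            inv_mul_cancel₀ (pow_ne_zero _ hp0.ne'), one_mul]
      _ ≤ ‖π‖ := inv_prime_le_norm_pi hπ
  · -- `p ∤ n + 1`: the term is `‖π‖^{n+1} ≤ ‖π‖`
    rw [padicValNat.eq_zero_of_not_dvd hdvd, pow_zero, mul_one]
    calc ‖π‖ ^ (n + 1) ≤ ‖π‖ ^ 1 := pow_le_pow_of_le_one hπ0 hπ1 (by omega)
      _ = ‖π‖ := pow_one _

/-! ### `‖log_p(1 + π)‖ = 1` -/

section Complete

variable [IsUltrametricDist K] [CompleteSpace K]

/-- **`‖log_p(1 + π)‖ = 1`** for `πᵖ = p`, `p` odd: abc-iut-S1's `unitLog (1 + π)` is the sum of the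
logarithmic series (`hasSum_unitLog`), whose term of index `p` has norm `1` and all of whose other terms
have norm `≤ ‖π‖ < 1`; by the ultrametric inequality the sum of the other terms has norm `≤ ‖π‖`, so the
total has norm exactly `1`. [cite: NeukirchANT1999, Ch. II (5.5)] -/
theorem norm_unitLog_one_add_pi_eq_one (hp2 : p ≠ 2) (hπ : π ^ p = p) : ‖unitLog (1 + π)‖ = 1 := by
  classical
  set f : ℕ → K := fun n ↦ -((1 - (1 + π)) ^ (n + 1)) / (n + 1 : K) with hf
  have hsum : HasSum f (unitLog (1 + π)) := hasSum_unitLog p (isPrincipal_one_add_pi hπ)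
  -- remove the dominant term of index `p - 1`
  have hsum' : HasSum (fun n ↦ if n = p - 1 then 0 else f n) (unitLog (1 + π) - f (p - 1)) :=
    hasSum_ite_sub_hasSum hsum (p - 1)
  have hrest : ‖unitLog (1 + π) - f (p - 1)‖ ≤ ‖π‖ := by
    rw [← hsum'.tsum_eq]
    refine IsUltrametricDist.norm_tsum_le_of_forall_le_of_nonneg (norm_nonneg π) fun n ↦ ?_
    by_cases hn : n = p - 1
    · rw [if_pos hn, norm_zero]; exact norm_nonneg π
    · rw [if_neg hn]
      have hn' : n + 1 ≠ p := by
        intro h; apply hn; omega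
      exact norm_logTerm_le_of_ne hp2 hπ hn'
  have hmain : ‖f (p - 1)‖ = 1 := norm_logTerm_prime hπ
  have hlt : ‖unitLog (1 + π) - f (p - 1)‖ < ‖f (p - 1)‖ := by
    rw [hmain]; exact hrest.trans_lt (norm_pi_lt_one hπ)
  have hsplit : unitLog (1 + π) = f (p - 1) + (unitLog (1 + π) - f (p - 1)) := by ring
  rw [hsplit, IsUltrametricDist.norm_add_eq_max_of_norm_ne_norm (ne_of_gt hlt), max_eq_left hlt.le,
    hmain]

/-- The same for the logarithmic series itself: `‖L(1 + π)‖ = 1`. [cite: NeukirchANT1999, Ch. II (5.5)] -/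
theorem norm_logSeries_one_add_pi_eq_one (hp2 : p ≠ 2) (hπ : π ^ p = p) : ‖logSeries (1 + π)‖ = 1 := by
  rw [← unitLog_of_isPrincipal p (isPrincipal_one_add_pi hπ)]
  exact norm_unitLog_one_add_pi_eq_one hp2 hπ

/-- There is a unit of `𝒪_K` (namely `1 + π`) whose logarithm is again a unit.
[cite: NeukirchANT1999, Ch. II (5.5)] -/
theorem exists_norm_unitLog_eq_one (hp2 : p ≠ 2) (hπ : π ^ p = p) :
    ∃ u : K, ‖u‖ = 1 ∧ ‖unitLog u‖ = 1 :=
  ⟨1 + π, norm_one_add_pi hπ, norm_unitLog_one_add_pi_eq_one hp2 hπ⟩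

/-- **`log_p(𝒪_K^×)` meets the unit sphere**: `logUnits K ∩ 𝒪_K^× ≠ ∅` (abc-iut-S1's
`logUnits K = log_p(𝒪_K^×)`). [cite: NeukirchANT1999, Ch. II (5.5)] -/
theorem logUnits_inter_sphere_nonempty (hp2 : p ≠ 2) (hπ : π ^ p = p) :
    (logUnits K ∩ sphere 0 1).Nonempty :=
  ⟨unitLog (1 + π), unitLog_mem_logUnits (norm_one_add_pi hπ),
    mem_sphere_zero_iff_norm.mpr (norm_unitLog_one_add_pi_eq_one hp2 hπ)⟩

/-- **`log_p(𝒪_K^×) ⊄ 𝔪_K`** (`𝔪_K = ball 0 1`): the conclusion of `UnitLogIntoMaximalIdeal`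
(`logUnits_subset_ball_of_absRamificationIdx_le`, `e ≤ p − 1`) FAILS here.
[cite: NeukirchANT1999, Ch. II (5.5)] -/
theorem not_logUnits_subset_ball (hp2 : p ≠ 2) (hπ : π ^ p = p) : ¬ logUnits K ⊆ ball 0 1 := by
  intro h
  have hmem := h (unitLog_mem_logUnits (norm_one_add_pi hπ) : unitLog (1 + π) ∈ logUnits K)
  rw [mem_ball_zero_iff, norm_unitLog_one_add_pi_eq_one hp2 hπ] at hmem
  exact lt_irrefl _ hmem

/-- The image under `log_p` of the units whose logarithm is a unit is NONEMPTY (the "second iterate" of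
`log_p` on units has inhabited domain). [cite: NeukirchANT1999, Ch. II (5.5)] -/
theorem unitLog_image_logUnits_inter_sphere_nonempty (hp2 : p ≠ 2) (hπ : π ^ p = p) :
    (unitLog '' (logUnits K ∩ sphere 0 1)).Nonempty :=
  (logUnits_inter_sphere_nonempty hp2 hπ).image _

end Complete

/-- **Such `K` are wildly ramified with `e ≥ p`**: `¬ e(K/ℚ_p) ≤ p − 1` — otherwise abc-iut-w5-d172's
`norm_unitLog_lt_one_of_absRamificationIdx_le` would give `‖log_p(1 + π)‖ < 1`.
[cite: NeukirchANT1999, Ch. II (5.5)] -/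
theorem not_absRamificationIdx_le_sub_one [IsUltrametricDist K] [ProperSpace K] (hp2 : p ≠ 2)
    (hπ : π ^ p = p) : ¬ absRamificationIdx p K ≤ p - 1 := by
  intro he
  have hlt := norm_unitLog_lt_one_of_absRamificationIdx_le p he (1 + π)
  rw [norm_unitLog_one_add_pi_eq_one hp2 hπ] at hlt
  exact lt_irrefl _ hlt

/-- … equivalently `p ≤ e(K/ℚ_p)`. [cite: NeukirchANT1999, Ch. II (5.5)] -/
theorem prime_le_absRamificationIdx [IsUltrametricDist K] [ProperSpace K] (hp2 : p ≠ 2)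
    (hπ : π ^ p = p) : p ≤ absRamificationIdx p K := by
  have := not_absRamificationIdx_le_sub_one hp2 hπ
  omega

/-! ### Non-vacuity: `ℚ_p(p^{1/p}) ⊆ ℚ̄_p` -/

open Polynomial IntermediateField in
variable (p) in
/-- **A finite `E ⊆ ℚ̄_p` with `π ∈ E`, `πᵖ = p`** (every prime `p`): adjoin to `ℚ_p` a `p`-th root of `p` in the
algebraically closed `ℚ̄_p = PadicAlgCl p`. [cite: NeukirchANT1999, Ch. II (5.5)] -/
theorem exists_subfield_pow_prime_eq :
    ∃ (E : IntermediateField ℚ_[p] (PadicAlgCl p)) (_ : FiniteDimensional ℚ_[p] E) (π : E), π ^ p = p := by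
  obtain ⟨α, hα⟩ := IsAlgClosed.exists_pow_nat_eq (p : PadicAlgCl p) hp.out.pos
  have heval : Polynomial.aeval α (X ^ p - C (p : ℚ_[p])) = 0 := by
    simp [hα]
  have hint : IsIntegral ℚ_[p] α := ⟨X ^ p - C (p : ℚ_[p]), monic_X_pow_sub_C _ hp.out.ne_zero, by
    simpa [Polynomial.aeval_def] using heval⟩
  haveI hfd : FiniteDimensional ℚ_[p] ℚ_[p]⟮α⟯ := adjoin.finiteDimensional hint
  refine ⟨ℚ_[p]⟮α⟯, hfd, ⟨α, mem_adjoin_simple_self ℚ_[p] α⟩, ?_⟩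
  apply Subtype.ext
  have hpE : ((p : ℚ_[p]⟮α⟯) : PadicAlgCl p) = p := map_natCast (algebraMap ℚ_[p]⟮α⟯ (PadicAlgCl p)) p
  simp [hα, hpE]

variable (p) in
/-- **For every odd prime `p` there is a finite `E ⊆ ℚ̄_p` and a unit of `𝒪_E` whose logarithm is a
unit** (`E = ℚ_p(p^{1/p})`, `u = 1 + p^{1/p}`): the hypotheses of this file are inhabited in the literal setting
"`k ⊆ ℚ̄_p` a finite extension of `ℚ_p`" of abc-iut-S1's `PadicSubfields`. [cite: NeukirchANT1999, Ch. II (5.5)] -/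
theorem exists_subfield_norm_unitLog_eq_one (hp2 : p ≠ 2) :
    ∃ (E : IntermediateField ℚ_[p] (PadicAlgCl p)) (_ : FiniteDimensional ℚ_[p] E) (u : E),
      ‖u‖ = 1 ∧ ‖unitLog u‖ = 1 := by
  obtain ⟨E, hfd, π, hπ⟩ := exists_subfield_pow_prime_eq p
  haveI : ProperSpace E := properSpace_subfield p E
  exact ⟨E, hfd, exists_norm_unitLog_eq_one hp2 hπ⟩

variable (p) in
/-- … and for every odd `p` a finite `E ⊆ ℚ̄_p` with `log_p(𝒪_E^×) ⊄ 𝔪_E` and `p ≤ e(E/ℚ_p)` (so the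
hypothesis `e ≤ p − 1` of `UnitLogIntoMaximalIdeal` genuinely excludes it). [cite: NeukirchANT1999, Ch. II (5.5)] -/
theorem exists_subfield_not_logUnits_subset_ball (hp2 : p ≠ 2) :
    ∃ (E : IntermediateField ℚ_[p] (PadicAlgCl p)) (_ : FiniteDimensional ℚ_[p] E),
      ¬ logUnits E ⊆ ball 0 1 ∧ p ≤ absRamificationIdx p E := by
  obtain ⟨E, hfd, π, hπ⟩ := exists_subfield_pow_prime_eq p
  haveI : ProperSpace E := properSpace_subfield p E
  exact ⟨E, hfd, not_logUnits_subset_ball hp2 hπ, prime_le_absRamificationIdx hp2 hπ⟩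

end WildPrime

end Literature.IUT.LogVolume

end
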